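/-
Copyright (c) 2026 the pub-hodgecm-mathlib formalisation cell (harness21).  Prover seat hodgecm-mathlib-K2E1-p15 (g3), Track B ∕ K2-LIT, h413 = `stmt-HodgeConjecture-24833`,
R90-TF section S8 «ContSpec-n½» (planner R90-CS-plan (g0), hand «p11» 2026-09-04T16:00:49Z; ruling S8-R8: the GENERIC half of socket #4 `sock_S8_resH_classification`'s assembly):
an irreducible closed subrepresentation inside the closed span of LINES is a line.
-/
import Summits.HodgeConjecture.HodgeConjecture.Theorems.R90S8IrreducibleMeetsOneBlock   -- ★ p861655 (this seat): «p09» `exists_le_block_equiv_of_le_topologicalClosure_iSup`; brings ★ #7, ★ `HilbertRepSpectrum(Proofs)`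
import Literature.NumberTheory.Automorphic.AutomorphicCharacterLine                       -- ★ `AutomorphicCharacter.lineSubrep`, `finrank_lineSubrep`; brings ★ `DiscreteAutomorphicRep`, `isUnitary_rightRegular`
import HarnessLib

/-!
# S8 «p11» — `R90S8OneDimOfLeClosureSupLines`: an irreducible closed subrepresentation `P ≤ closure (⨆ᵢ Bᵢ)` of a unitary representation, all blocks `Bᵢ` being LINES, is a line;
# hence a discrete automorphic representation inside the closed span of character lines `ℂ·ψᵢ` is one-dimensional

Track B ∕ K2-LIT, crux h413 = `stmt-HodgeConjecture-24833`, route of record `HCCMUnconditional`; cell `hodgecm-mathlib`, R90-TF programme, section S8 «ContSpec-n½»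
(§13.9 residual spectrum).  RULING S8-R8: socket #4 `sock_S8_resH_classification` («every irreducible of `L²_res(U(Φ₂))` is a character line») := THIS FILE (generic half) ∘ ★
p861603 `charLine₂_of_isOneDimensional` ∘ the one E1-content socket `sock_S8_resH_spannedByCharLines` («`L²_res(U(Φ₂)) ≤ closure (⨆_ψ ℂ·(ψ∘det))`»).  THEOREMS ONLY (no `def`,
no `instance`, no `notation`, no named-fact hypothesis, no `sorry`; default heartbeats); lane `--supports stmt-HodgeConjecture-24833 --as helper` (count-neutral).

THE MATHEMATICS ([Dixmier1977, §5.4, §13.1]; [BorelJacquet1979, §4.6]).  Let `π` be unitary, `(Bᵢ)ᵢ` closed invariant LINES (`dim Bᵢ = 1`; no orthogonality assumed) and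
`P` a topologically irreducible closed invariant subspace with `P ≤ closure (Σᵢ Bᵢ)`.  By «p09» (★ `exists_le_block_equiv_of_le_topologicalClosure_iSup`) there are `i` and an
irreducible closed `P′ ≤ Bᵢ` with `P ≃ᵤ P′`.  Then `P′ ≠ 0` (irreducible, ★ `isTopIrreducible_iff`) and `P′ ↪ Bᵢ` is an injective linear map into a line, so
`1 ≤ dim P′ ≤ 1` (Mathlib `Module.finrank_pos_iff`, `LinearMap.finrank_le_finrank_of_injective`); the equivalence `P ≃ P′` is in particular a linear isomorphism,
so `dim P = dim P′ = 1` (`LinearEquiv.finrank_eq`).  AUTOMORPHIC PRINT: for `π = R` the right-regular representation on `L²(G(K)\G(𝔸_K))` (unitary, ★ `isUnitary_rightRegular`)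
and the character lines `Bᵢ = ℂ·ψᵢ` (★ `AutomorphicCharacter.lineSubrep`, `dim = 1` by ★ `finrank_lineSubrep`), a discrete automorphic `P ≤ closure (⨆ᵢ ℂ·ψᵢ)` is
one-dimensional (★ `DiscreteAutomorphicRep.IsOneDimensional`).
* §1 **`finrank_eq_one_of_le_topologicalClosure_iSup`** — generic: lines in, line out.
* §2 **`isOneDimensional_of_le_topologicalClosure_iSup_lineSubrep`** — THE HEAD for S8-R8 (any adelic datum `𝒢`, any family of automorphic characters).
HONEST LABEL: HC_CM is proved only modulo the 7 printed citations (2 remaining named inputs: hLiu418 = `stmt-HodgeConjecture-24832`, h413 = `stmt-HodgeConjecture-24833`) until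
rung 0 closes; this file asserts no named fact and closes no socket; count-neutral.

## References
* [Dixmier1977] J. Dixmier, *C\*-algebras* (North-Holland, 1977), §5.4, §13.1.
* [BorelJacquet1979] A. Borel, H. Jacquet, *Automorphic forms and automorphic representations*, Proc. Sympos. Pure Math. 33.1 (1979), §4.6.
-/

set_option autoImplicit false
set_option linter.dupNamespace false  -- the mandated namespace `…HodgeConjecture.HodgeConjecture.R90.S8` (LEAD #1 L1) repeats the summit's segment

noncomputable section

universe u

open MeasureTheory
open Literature.NumberTheory.Automorphic

namespace Summit.HodgeConjecture.HodgeConjecture.R90.S8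

open ContRepresentation

/-! ## §1 Generic: an irreducible inside the closed span of lines is a line -/

section Generic

variable {G H : Type*} [Group G] [NormedAddCommGroup H] [InnerProductSpace ℂ H] [CompleteSpace H]
  {π : ContRepresentation ℂ G H}

/-- **«p11» (generic) — lines in, line out.**  For `π` unitary, a family `B : ι → ClosedSubrep π` of LINES (`finrank ℂ (B i) = 1`, no orthogonality assumed) and a
topologically irreducible closed subrepresentation `P ≤ (⨆ i, B i).topologicalClosure`: `finrank ℂ P = 1`.  By ★ «p09» `P ≃ᵤ P′ ≤ B i` with `P′` irreducible, and
`1 ≤ finrank P′ ≤ finrank (B i) = 1` (`P′ ≠ 0` by ★ `isTopIrreducible_iff`; injective inclusion into a line), transported along the linear isomorphism underlying the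
equivalence (`LinearEquiv.finrank_eq`). [cite: Dixmier1977, §5.4, §13.1] -/
theorem finrank_eq_one_of_le_topologicalClosure_iSup (hπ : π.IsUnitary) {ι : Type*} (B : ι → ClosedSubrep π)
    (hB : ∀ i, Module.finrank ℂ (B i).toSubmodule = 1) (P : ClosedSubrep π) (hP : P.toContRep.IsTopIrreducible)
    (hle : P.toSubmodule ≤ (⨆ i, (B i).toSubmodule).topologicalClosure) :
    Module.finrank ℂ P.toSubmodule = 1 := by
  obtain ⟨i, P', hP'le, hP'irr, e, -⟩ := exists_le_block_equiv_of_le_topologicalClosure_iSup hπ B P hP hle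
  -- `B i` is a line, hence finite-dimensional; `P' ↪ B i` injectively
  haveI : Module.Finite ℂ (B i).toSubmodule := Module.finite_of_finrank_eq_succ (hB i)
  have hinj : Function.Injective (Submodule.inclusion (ClosedSubrep.toSubmodule_le_iff.mpr hP'le)) :=
    Submodule.inclusion_injective _
  haveI : Module.Finite ℂ P'.toSubmodule := Module.Finite.of_injective _ hinj
  have hle1 : Module.finrank ℂ P'.toSubmodule ≤ 1 := (hB i) ▸ LinearMap.finrank_le_finrank_of_injective hinj
  -- `P'` is irreducible, hence non-trivial, hence of positive rank
  have hnt : Nontrivial P'.toSubmodule := ((isTopIrreducible_iff _).mp hP'irr).1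
  have hpos : 0 < Module.finrank ℂ P'.toSubmodule := Module.finrank_pos_iff.mpr hnt
  -- transport along the linear isomorphism underlying `e : P ≃ P'`
  rw [e.toContinuousLinearEquiv.toLinearEquiv.finrank_eq]
  omega

end Generic

/-! ## §2 The automorphic print: inside the closed span of character lines ⟹ one-dimensional -/

section Automorphic

variable {K : Type} [Field K] [NumberField K] {𝒢 : AdelicGroupData.{u} K}
  {μ : Measure 𝒢.automorphicQuotient} [𝒢.IsAutomorphicMeasure μ]

/-- **«p11» (head) — a discrete automorphic representation inside the closed span of character lines is one-dimensional.**  For any adelic datum `𝒢`, automorphic measure `μ`,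
any family `ψ : ι → 𝒢.AutomorphicCharacter` and `P : DiscreteAutomorphicRep 𝒢 μ` with `P.space ≤ (⨆ i, ℂ·ψ̄ᵢ).topologicalClosure` (★ `AutomorphicCharacter.lineSubrep`):
`P.IsOneDimensional`.  §1 at the unitary right-regular representation (★ `isUnitary_rightRegular`), the lines having `finrank = 1` (★ `finrank_lineSubrep`) and `P`
being irreducible (`P.irreducible`). [cite: BorelJacquet1979, §4.6] [cite: Dixmier1977, §5.4] -/
theorem isOneDimensional_of_le_topologicalClosure_iSup_lineSubrep {ι : Type*} (ψ : ι → 𝒢.AutomorphicCharacter)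
    (P : DiscreteAutomorphicRep 𝒢 μ) (hle : P.space.toSubmodule ≤ (⨆ i, ((ψ i).lineSubrep μ).toSubmodule).topologicalClosure) :
    P.IsOneDimensional :=
  finrank_eq_one_of_le_topologicalClosure_iSup (𝒢.isUnitary_rightRegular μ) (fun i => (ψ i).lineSubrep μ)
    (fun i => (ψ i).finrank_lineSubrep μ) P.space P.irreducible hle

end Automorphic

end Summit.HodgeConjecture.HodgeConjecture.R90.S8

end
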